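import Literature.MathematicalPhysics.QuantumLattice.TorusSectorPartitionFnMixedTiling
import Literature.MathematicalPhysics.QuantumLattice.SectorPartitionFnGrandCanonicalBound
import HarnessLib

/-!
# The filling-box producer of the free-energy route at `T > 0`: thermal energy windows for every
# torus-limit thermal state at EVERY filling of an interval from two open-box partition functions
# (torus-limit thermal convention)

Family `hubbard` (topic `MathematicalPhysics/QuantumLattice`; the thermodynamic-limit consumer of
`TorusSectorPartitionFnMixedTiling` (the canonical torus free energy lies below the chord of two box free
energies at every filling `n ∈ [2p/a², 2(p+1)/a²]`, with an `O(1)` defect), built on the chord theorems of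
`TorusSectorGibbsEnergyWindow` and the canonical ≤ grand-canonical bridge of
`SectorPartitionFnGrandCanonicalBound`). Written for the FILLING leg of the material-oracle interface
BOX → WORD at positive temperature (Hubbard programme, stage S1/S2 (iii); the phase map's `T × n` cells): the
open-box producer of record (`TorusSectorGibbsOpenBoxBound` §3) binds only fillings COMMENSURATE with the box,
`halfRectN n L = K²a₀`; a downfolded material arrives with a filling INTERVAL. Here, along box-built tori
`L_j = K_j a` (`K_j ≥ 2`; NO commensurability hypothesis — e.g. `L_j = a(j+2)`, §3), for every
`n ∈ [2p/a², 2(p+1)/a²]` (`p + 1 ≤ a²`), every torus limit `ω` of the canonical sector Gibbs states of the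
`t–t'` Hubbard model at `(β; n)`, and certified floors `0 < z_p ≤ Re Z_β(box; p,p)`, `0 < z_q ≤ Re Z_β(box; p+1,p+1)`
of the two OPEN `a × a` box partition functions, with `chord(n) = (log z_p + λ(n)(log z_q − log z_p))/a²`,
`λ(n) = n a²/2 − p`:

* §1 DEFECT-TOLERANT CHORDS. The thermodynamic-limit chord theorems tolerate `o(L²)` defects in both
  free-energy hypotheses: `…le_entropy_sub_div_of_sectorGibbs_of_forall_pos`, `…le_chord_of_sectorGibbs_of_forall_pos`,
  `…chord_le_meanEnergy…_of_forall_pos` (hypotheses `∀ ε > 0, eventually (ℓ − ε)L² ≤ log Z_{L,β}` /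
  `log Z_{L,β'} ≤ (u + ε)L²`); constant defects are such (`eventually_sub_mul_sq_le_of_sub_const_le`,
  `eventually_le_add_mul_sq_of_le_add_const`). And ONE grand-canonical pressure bound
  `log Re Z_{β_h}(H_L − μN) ≤ P·L²` is a hot free-energy bound `(P − β_h μ n)·L² + 2|β_h μ|` at EVERY filling
  `0 ≤ n ≤ 2` — affine in `n` (`eventually_log_partitionFn_sectorHamiltonianTT'_le_of_grandCanonical`).
* §2 THE PRODUCERS on the filling interval:
  I `…le_entropy_sub_chord_div_of_fillingBox`: `e_Φ(ω) ≤ (s − chord(n))/β` whenever `2H_b(n/2) < s` — two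
    box partition functions alone; at the box densities it is the commensurate producer of record;
  II `…le_hot_sub_chord_div_of_fillingBox`: `e_Φ(ω) ≤ (u_h − chord(n))/(β − β_h)` with a hot free-energy bound
    (constant defect allowed); III `…le_grandCanonical_sub_chord_div_of_fillingBox`:
    `e_Φ(ω) ≤ (P − β_h μ n − chord(n))/(β − β_h)` from ONE grand-canonical pressure bound at `(β_h, μ)`;
  IV `chord_sub_cold_div_le_meanEnergy…_of_fillingBox`: `(chord(n) − u_c)/(β_c − β) ≤ e_Φ(ω)` (a FLOOR) with
    a cold free-energy bound; and the interval-uniform forms `…le_entropy_sub_min_div_of_fillingBox`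
    (`min(log z_p, log z_q)/a²` in place of the chord) and, on a hole-doped interval `2(p+1)/a² ≤ 1`,
    `…le_of_fillingBox_holeDoped`: ONE number `(s − min(log z_p, log z_q)/a²)/β`, `s > 2H_b((p+1)/a²)`, for
    every filling — the `T > 0` twin of the filling-box cap `energyDensityTT'_le_max_of_mem_Icc`.
* §3 the tori `L_j = a(j+2)` satisfy the box hypothesis (`eventually_exists_box_decomposition`, `tendsto_box_tori`).
The lower edge of the thermal window on the interval is the cut row `e(t,t',U,n) ≤ e_Φ(ω)`
(`IsTorusLimitOfMixture.energyDensityTT'_le_meanEnergy_of_sectorGibbs`) read through the `T = 0`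
filling-box floors of `HubbardFillingBoxEnergyBounds`; nothing is restated. A filling box straddling a box
density (e.g. `[0.865, 0.885] ∋ 7/8` with `4 × 4` boxes) is the union of two such intervals: three box partition
functions `(6,6), (7,7), (8,8)` serve it.

HONEST SCOPE: transport/producer lemmas — no number, no certificate, no phase word; no thermodynamic-limit
free-energy function is constructed and no convexity of the true free energy is asserted. Everything is
PROVED; no definition, no named fact.

## References

* D. Ruelle, *Statistical Mechanics: Rigorous Results* (1969), §2.5–2.6 (convexity of `log Z` in `β`), §3.3
  eqs. (3.16)–(3.18) (sub-boxes with different particle numbers), §3.4 (canonical vs grand-canonical).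
  [cite: Ruelle1969, §3.3 (3.16)–(3.18); §3.4]
* R. B. Israel, *Convexity in the Theory of Lattice Gases* (1979), Lemma II.3.1. [cite: Israel1979, Lemma II.3.1]
* J. P. F. LeBlanc et al., Phys. Rev. X 5 (2015) 041041, eq. (1). [cite: LeBlancEtAl2015, eq. (1)]

## Mathlib / tree search

REUSED: `chord_mul_sq_sub_abs_le_log_partitionFn_sectorHamiltonianTT'`, `min_log_div_sq_le_chord`
(`TorusSectorPartitionFnMixedTiling`); `IsTorusLimitOfMixture.meanEnergy_hubbardTTPrime_le_chord_of_sectorGibbs`,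
`…chord_le_meanEnergy_hubbardTTPrime_of_sectorGibbs`, `…le_entropy_sub_div_of_sectorGibbs`
(`TorusSectorGibbsEnergyWindow`); `eventually_log_sectorGibbsCount_le` (`TorusSectorGibbsMixture`);
`log_partitionFn_sectorHamiltonianTT'_le_grandCanonical` (`SectorPartitionFnGrandCanonicalBound`); `rectN`,
`rectN_le`; `Real.binEntropy_strictMonoOn`.
-/

noncomputable section

namespace Literature.MathematicalPhysics.QuantumLattice

open Matrix Finset HubbardWave0 ThermodynamicLimit LiebThm1 Literature.Probability.LatticeModels
open _root_.Filter
open scoped _root_.Topology ComplexOrder BigOperators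

/-! ### §1 Defect-tolerant forms of the thermodynamic-limit chord theorems; the grand-canonical hot bound
at every filling -/

section Slack

/-- A constant defect in a per-volume LOWER bound is an `o(L²)` defect: `ℓ·L_j² − C ≤ F_j` eventually and
`L_j → ∞` give `(ℓ − ε)·L_j² ≤ F_j` eventually, for every `ε > 0` (Ruelle's absorption of additive defects per
volume). [cite: Ruelle1969, §3.3 (3.13)–(3.15)] -/
theorem eventually_sub_mul_sq_le_of_sub_const_le {Ls : ℕ → ℕ} (hLs : Tendsto Ls atTop atTop)
    {F : ℕ → ℝ} {ℓ C : ℝ} (h : ∀ᶠ j in atTop, ℓ * (Ls j : ℝ) ^ 2 - C ≤ F j) {ε : ℝ} (hε : 0 < ε) :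
    ∀ᶠ j in atTop, (ℓ - ε) * (Ls j : ℝ) ^ 2 ≤ F j := by
  have hR : Tendsto (fun j => (Ls j : ℝ)) atTop atTop := tendsto_natCast_atTop_atTop.comp hLs
  filter_upwards [h, hR.eventually_ge_atTop (max 1 (C / ε))] with j hj hL
  have h1 : (1 : ℝ) ≤ Ls j := le_trans (le_max_left _ _) hL
  have h2 : C / ε ≤ Ls j := le_trans (le_max_right _ _) hL
  rw [div_le_iff₀ hε] at h2
  have h3 : (Ls j : ℝ) * ε ≤ ε * (Ls j : ℝ) ^ 2 := by
    nlinarith [mul_nonneg hε.le (sub_nonneg.mpr h1)]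
  nlinarith

/-- A constant defect in a per-volume UPPER bound is an `o(L²)` defect: `F_j ≤ u·L_j² + C` eventually and
`L_j → ∞` give `F_j ≤ (u + ε)·L_j²` eventually, for every `ε > 0` (Ruelle's absorption of additive defects per
volume). [cite: Ruelle1969, §3.3 (3.13)–(3.15)] -/
theorem eventually_le_add_mul_sq_of_le_add_const {Ls : ℕ → ℕ} (hLs : Tendsto Ls atTop atTop)
    {F : ℕ → ℝ} {u C : ℝ} (h : ∀ᶠ j in atTop, F j ≤ u * (Ls j : ℝ) ^ 2 + C) {ε : ℝ} (hε : 0 < ε) :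
    ∀ᶠ j in atTop, F j ≤ (u + ε) * (Ls j : ℝ) ^ 2 := by
  have h' : ∀ᶠ j in atTop, (-u) * (Ls j : ℝ) ^ 2 - C ≤ -F j := by
    filter_upwards [h] with j hj
    linarith
  filter_upwards [eventually_sub_mul_sq_le_of_sub_const_le hLs h' hε] with j hj
  linarith

namespace InfVolFermionState

variable {t t' U n β : ℝ} {ω : InfVolFermionState 2} {Ls : ℕ → ℕ}

/-- **Infinite-temperature chord with an `o(L²)`-tolerant free-energy hypothesis**: if for every `ε > 0`
eventually `(ℓ − ε)·L² ≤ log Z_{L,β}` and eventually `log #sector_L ≤ s·L²` (`β > 0`), then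
`e_{Φ(t,t',U)}(ω) ≤ (s − ℓ)/β` for every torus limit `ω` of the canonical sector Gibbs states at `β`.
[cite: Israel1979, Lemma II.3.1] [cite: Ruelle1969, §2.5–2.6] -/
theorem IsTorusLimitOfMixture.meanEnergy_hubbardTTPrime_le_entropy_sub_div_of_sectorGibbs_of_forall_pos
    (hn0 : 0 ≤ n) (hn2 : n ≤ 2)
    (h : ω.IsTorusLimitOfMixture (sectorGibbsCount n) (fun L => sectorGibbsWeightTT' β t t' U n L)
      (fun L => sectorGibbsVectorTT' t t' U n L) Ls)
    (hLs : Tendsto Ls atTop atTop) (hβ : 0 < β) {ℓ s : ℝ}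
    (hℓ : ∀ ε : ℝ, 0 < ε → ∀ᶠ j in atTop, (ℓ - ε) * (Ls j : ℝ) ^ 2 ≤
      Real.log (partitionFn β (sectorHamiltonianTT' t t' U n (Ls j))).re)
    (hs : ∀ᶠ j in atTop, Real.log (sectorGibbsCount n (Ls j)) ≤ s * (Ls j : ℝ) ^ 2) :
    ω.meanEnergy (hubbardTTPrimeFermionInteraction t t' U) 1 ≤ (s - ℓ) / β := by
  refine le_of_forall_pos_le_add fun ε hε => ?_
  have h1 := h.meanEnergy_hubbardTTPrime_le_entropy_sub_div_of_sectorGibbs hn0 hn2 hLs hβ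
    (hℓ (β * ε) (mul_pos hβ hε)) hs
  have h2 : (s - (ℓ - β * ε)) / β = (s - ℓ) / β + ε := by
    field_simp
    ring
  rw [h2] at h1
  exact h1

/-- **Hot chord with `o(L²)`-tolerant free-energy hypotheses** (`0 < β_h < β`): if for every `ε > 0`
eventually `(ℓ − ε)·L² ≤ log Z_{L,β}` and `log Z_{L,β_h} ≤ (u_h + ε)·L²`, then
`e_{Φ(t,t',U)}(ω) ≤ (u_h − ℓ)/(β − β_h)`. [cite: Ruelle1969, §2.5–2.6] [cite: Israel1979, Lemma II.3.1] -/
theorem IsTorusLimitOfMixture.meanEnergy_hubbardTTPrime_le_chord_of_sectorGibbs_of_forall_pos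
    (hn0 : 0 ≤ n) (hn2 : n ≤ 2)
    (h : ω.IsTorusLimitOfMixture (sectorGibbsCount n) (fun L => sectorGibbsWeightTT' β t t' U n L)
      (fun L => sectorGibbsVectorTT' t t' U n L) Ls)
    (hLs : Tendsto Ls atTop atTop) {βh ℓ uh : ℝ} (hβh : 0 < βh) (hlt : βh < β)
    (hℓ : ∀ ε : ℝ, 0 < ε → ∀ᶠ j in atTop, (ℓ - ε) * (Ls j : ℝ) ^ 2 ≤
      Real.log (partitionFn β (sectorHamiltonianTT' t t' U n (Ls j))).re)
    (huh : ∀ ε : ℝ, 0 < ε → ∀ᶠ j in atTop,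
      Real.log (partitionFn βh (sectorHamiltonianTT' t t' U n (Ls j))).re ≤ (uh + ε) * (Ls j : ℝ) ^ 2) :
    ω.meanEnergy (hubbardTTPrimeFermionInteraction t t' U) 1 ≤ (uh - ℓ) / (β - βh) := by
  have hgap : 0 < β - βh := sub_pos.mpr hlt
  refine le_of_forall_pos_le_add fun ε hε => ?_
  have hδ : 0 < (β - βh) * ε / 2 := by positivity
  have h1 := h.meanEnergy_hubbardTTPrime_le_chord_of_sectorGibbs hn0 hn2 hLs hβh hlt
    (hℓ _ hδ) (huh _ hδ)
  have h2 : (uh + (β - βh) * ε / 2 - (ℓ - (β - βh) * ε / 2)) / (β - βh) = (uh - ℓ) / (β - βh) + ε := by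
    field_simp
    ring
  rw [h2] at h1
  exact h1

/-- **Cold chord with `o(L²)`-tolerant free-energy hypotheses** (`0 < β < β_c`): if for every `ε > 0`
eventually `(ℓ − ε)·L² ≤ log Z_{L,β}` and `log Z_{L,β_c} ≤ (u_c + ε)·L²`, then
`(ℓ − u_c)/(β_c − β) ≤ e_{Φ(t,t',U)}(ω)`. [cite: Ruelle1969, §2.5–2.6] [cite: Israel1979, Lemma II.3.1] -/
theorem IsTorusLimitOfMixture.chord_le_meanEnergy_hubbardTTPrime_of_sectorGibbs_of_forall_pos
    (hn0 : 0 ≤ n) (hn2 : n ≤ 2)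
    (h : ω.IsTorusLimitOfMixture (sectorGibbsCount n) (fun L => sectorGibbsWeightTT' β t t' U n L)
      (fun L => sectorGibbsVectorTT' t t' U n L) Ls)
    (hLs : Tendsto Ls atTop atTop) {βc ℓ uc : ℝ} (hβ : 0 < β) (hlt : β < βc)
    (hℓ : ∀ ε : ℝ, 0 < ε → ∀ᶠ j in atTop, (ℓ - ε) * (Ls j : ℝ) ^ 2 ≤
      Real.log (partitionFn β (sectorHamiltonianTT' t t' U n (Ls j))).re)
    (huc : ∀ ε : ℝ, 0 < ε → ∀ᶠ j in atTop,
      Real.log (partitionFn βc (sectorHamiltonianTT' t t' U n (Ls j))).re ≤ (uc + ε) * (Ls j : ℝ) ^ 2) :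
    (ℓ - uc) / (βc - β) ≤ ω.meanEnergy (hubbardTTPrimeFermionInteraction t t' U) 1 := by
  have hgap : 0 < βc - β := sub_pos.mpr hlt
  -- `x ≤ e` from `x − ε ≤ e` for all `ε > 0`
  have key : ∀ ε : ℝ, 0 < ε → (ℓ - uc) / (βc - β) - ε ≤ ω.meanEnergy (hubbardTTPrimeFermionInteraction t t' U) 1 := by
    intro ε hε
    have hδ : 0 < (βc - β) * ε / 2 := by positivity
    have h1 := h.chord_le_meanEnergy_hubbardTTPrime_of_sectorGibbs hn0 hn2 hLs hβ hlt
      (hℓ _ hδ) (huc _ hδ)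
    have h2 : (ℓ - (βc - β) * ε / 2 - (uc + (βc - β) * ε / 2)) / (βc - β) = (ℓ - uc) / (βc - β) - ε := by
      field_simp
      ring
    rw [h2] at h1
    exact h1
  refine le_of_forall_pos_le_add fun ε hε => ?_
  linarith [key ε hε]

end InfVolFermionState

/-- **One grand-canonical pressure bound is a hot free-energy bound at EVERY filling** (affine in `n`):
if eventually `log Re Z_{β_h}(H_L(t,t',U) − μN) ≤ P·L²` along `Ls`, then for every `0 ≤ n ≤ 2` eventually
`log Re Z_{β_h}(sectorHamiltonianTT' t t' U n L) ≤ (P − β_h μ n)·L² + 2|β_h μ|` (canonical ≤ grand-canonical,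
`rectN n L ∈ (nL² − 2, nL²]`). [cite: Ruelle1969, §3.4] -/
theorem eventually_log_partitionFn_sectorHamiltonianTT'_le_of_grandCanonical (t t' U : ℝ) {n : ℝ}
    (hn0 : 0 ≤ n) (hn2 : n ≤ 2) (βh μ : ℝ) {Ls : ℕ → ℕ} {P : ℝ}
    (hP : ∀ᶠ j in atTop, Real.log (partitionFn βh (hubbardTorusTT' (Ls j) t t' U -
      (μ : ℂ) • totalNumber)).re ≤ P * (Ls j : ℝ) ^ 2) :
    ∀ᶠ j in atTop, Real.log (partitionFn βh (sectorHamiltonianTT' t t' U n (Ls j))).re ≤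
      (P - βh * μ * n) * (Ls j : ℝ) ^ 2 + 2 * |βh * μ| := by
  filter_upwards [hP] with j hj
  have h := log_partitionFn_sectorHamiltonianTT'_le_grandCanonical t t' U hn0 hn2 (Ls j) βh μ
  have hr1 : (rectN n (Ls j) : ℝ) ≤ n * (Ls j : ℝ) ^ 2 := rectN_le hn0 (Ls j)
  have hr2 : n * (Ls j : ℝ) ^ 2 - 2 ≤ (rectN n (Ls j) : ℝ) := by
    have hfl := Nat.lt_floor_add_one (n * (Ls j : ℝ) ^ 2 / 2)
    have e : (rectN n (Ls j) : ℝ) = 2 * (⌊n * (Ls j : ℝ) ^ 2 / 2⌋₊ : ℝ) := by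
      unfold rectN; push_cast; ring
    rw [e]
    linarith
  have hd : |(rectN n (Ls j) : ℝ) - n * (Ls j : ℝ) ^ 2| ≤ 2 := by
    rw [abs_le]; constructor <;> linarith
  have key : -(βh * μ * (rectN n (Ls j) : ℝ)) ≤ -(βh * μ * (n * (Ls j : ℝ) ^ 2)) + 2 * |βh * μ| := by
    have h3 : -(βh * μ) * ((rectN n (Ls j) : ℝ) - n * (Ls j : ℝ) ^ 2) ≤ |βh * μ| * 2 := by
      calc -(βh * μ) * ((rectN n (Ls j) : ℝ) - n * (Ls j : ℝ) ^ 2)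
          ≤ |-(βh * μ) * ((rectN n (Ls j) : ℝ) - n * (Ls j : ℝ) ^ 2)| := le_abs_self _
        _ = |βh * μ| * |(rectN n (Ls j) : ℝ) - n * (Ls j : ℝ) ^ 2| := by rw [abs_mul, abs_neg]
        _ ≤ |βh * μ| * 2 := mul_le_mul_of_nonneg_left hd (abs_nonneg _)
    linarith
  linarith

end Slack

/-! ### §2 The producers on a filling interval (thermodynamic limit along box-built tori) -/

namespace InfVolFermionState

variable {t t' U n β : ℝ} {ω : InfVolFermionState 2} {Ls : ℕ → ℕ}

/-- **The chord free-energy floor along box-built tori, in the `o(L²)`-tolerant form.** If eventually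
`Ls j = K_j a` with `K_j ≥ 2` (`p + 1 ≤ a²`, `2p/a² ≤ n ≤ 2(p+1)/a²`) and `0 < z_p ≤ Re Z_β(box; p,p)`,
`0 < z_q ≤ Re Z_β(box; p+1,p+1)` (`β ≥ 0`), then for every `ε > 0` eventually
`(chord(n) − ε)·L_j² ≤ log Re Z_β(sectorHamiltonianTT' t t' U n L_j)`. [cite: Ruelle1969, §3.3 (3.16)–(3.18)]
[cite: Israel1979, Lemma II.3.1] -/
theorem eventually_chord_sub_mul_sq_le_log_partitionFn (t t' U n : ℝ) {β : ℝ} (hβ : 0 ≤ β)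
    {a p : ℕ} (ha : 1 ≤ a) (hp : p + 1 ≤ a * a)
    (hlo : 2 * (p : ℝ) / (a : ℝ) ^ 2 ≤ n) (hhi : n ≤ 2 * ((p : ℝ) + 1) / (a : ℝ) ^ 2)
    {zp zq : ℝ} (hzp0 : 0 < zp)
    (hzp : zp ≤ (partitionFn β (spinSectorHamiltonian p p (hubbardOpenBoxTT' a a t t' U))).re)
    (hzq0 : 0 < zq)
    (hzq : zq ≤ (partitionFn β (spinSectorHamiltonian (p + 1) (p + 1) (hubbardOpenBoxTT' a a t t' U))).re)
    (hLs : Tendsto Ls atTop atTop) (hbox : ∀ᶠ j in atTop, ∃ K, 2 ≤ K ∧ Ls j = K * a)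
    {ε : ℝ} (hε : 0 < ε) :
    ∀ᶠ j in atTop,
      ((Real.log zp + (n * (a : ℝ) ^ 2 / 2 - p) * (Real.log zq - Real.log zp)) / (a : ℝ) ^ 2 - ε) *
          (Ls j : ℝ) ^ 2 ≤
        Real.log (partitionFn β (sectorHamiltonianTT' t t' U n (Ls j))).re := by
  refine eventually_sub_mul_sq_le_of_sub_const_le hLs (C := |Real.log zq - Real.log zp|) ?_ hε
  filter_upwards [hbox] with j hj
  obtain ⟨K, hK, hLj⟩ := hj
  exact chord_mul_sq_sub_abs_le_log_partitionFn_sectorHamiltonianTT' t t' U hβ ha hK hLj hp hlo hhi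
    hzp0 hzp hzq0 hzq

/-- **FILLING-BOX PRODUCER I — two box partition functions alone** (torus-limit thermal convention). Let
`p + 1 ≤ a²` and `2p/a² ≤ n ≤ 2(p+1)/a²` (so `0 ≤ n ≤ 2`), let `ω` be a torus limit of the canonical sector
Gibbs states of the `t–t'` Hubbard model at `(β; n)`, `β > 0`, along tori eventually of the form
`Ls j = K_j a`, `K_j ≥ 2` (NO commensurability of the sector with the boxes is required), and let
`0 < z_p ≤ Re Z_β(H^open_{a×a}(t,t',U); p, p)`, `0 < z_q ≤ Re Z_β(H^open_{a×a}(t,t',U); p+1, p+1)` be certified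
box partition-function floors. Then for every `s > 2 H_b(n/2)`
`e_{Φ(t,t',U)}(ω) ≤ (s − (log z_p + λ(log z_q − log z_p))/a²)/β`, `λ = n a²/2 − p` —
the infinite-temperature chord anchored at the CHORD of the two box free energies; at the box densities
`n = 2p/a²`, `2(p+1)/a²` it is the commensurate producer of `TorusSectorGibbsOpenBoxBound`.
[cite: Ruelle1969, §3.3 (3.16)–(3.18); §3.4.3] [cite: Israel1979, Lemma II.3.1] -/
theorem IsTorusLimitOfMixture.meanEnergy_hubbardTTPrime_le_entropy_sub_chord_div_of_fillingBox
    {a p : ℕ} (ha : 1 ≤ a) (hp : p + 1 ≤ a * a)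
    (hlo : 2 * (p : ℝ) / (a : ℝ) ^ 2 ≤ n) (hhi : n ≤ 2 * ((p : ℝ) + 1) / (a : ℝ) ^ 2)
    (h : ω.IsTorusLimitOfMixture (sectorGibbsCount n) (fun L => sectorGibbsWeightTT' β t t' U n L)
      (fun L => sectorGibbsVectorTT' t t' U n L) Ls)
    (hLs : Tendsto Ls atTop atTop) (hβ : 0 < β) (hbox : ∀ᶠ j in atTop, ∃ K, 2 ≤ K ∧ Ls j = K * a)
    {zp zq : ℝ} (hzp0 : 0 < zp)
    (hzp : zp ≤ (partitionFn β (spinSectorHamiltonian p p (hubbardOpenBoxTT' a a t t' U))).re)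
    (hzq0 : 0 < zq)
    (hzq : zq ≤ (partitionFn β (spinSectorHamiltonian (p + 1) (p + 1) (hubbardOpenBoxTT' a a t t' U))).re)
    {s : ℝ} (hs : 2 * Real.binEntropy (n / 2) < s) :
    ω.meanEnergy (hubbardTTPrimeFermionInteraction t t' U) 1 ≤
      (s - (Real.log zp + (n * (a : ℝ) ^ 2 / 2 - p) * (Real.log zq - Real.log zp)) / (a : ℝ) ^ 2) / β := by
  obtain ⟨hn0, hn2⟩ := filling_bounds_of_box_interval ha hp hlo hhi
  exact h.meanEnergy_hubbardTTPrime_le_entropy_sub_div_of_sectorGibbs_of_forall_pos hn0 hn2 hLs hβ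
    (fun ε hε => eventually_chord_sub_mul_sq_le_log_partitionFn t t' U n hβ.le ha hp hlo hhi hzp0 hzp
      hzq0 hzq hLs hbox hε)
    (hLs.eventually (eventually_log_sectorGibbsCount_le hn0 hn2 hs))

/-- **FILLING-BOX PRODUCER II — hot chord** (`0 < β_h < β`): with `ω`, the interval, the box floors and the
tori as in producer I, and a hot free-energy bound with a constant defect,
`log Re Z_{β_h}(sectorHamiltonianTT' t t' U n L_j) ≤ u_h·L_j² + C` eventually, one gets
`e_{Φ(t,t',U)}(ω) ≤ (u_h − chord(n))/(β − β_h)`. [cite: Ruelle1969, §2.5–2.6, §3.3 (3.16)–(3.18)]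
[cite: Israel1979, Lemma II.3.1] -/
theorem IsTorusLimitOfMixture.meanEnergy_hubbardTTPrime_le_hot_sub_chord_div_of_fillingBox
    {a p : ℕ} (ha : 1 ≤ a) (hp : p + 1 ≤ a * a)
    (hlo : 2 * (p : ℝ) / (a : ℝ) ^ 2 ≤ n) (hhi : n ≤ 2 * ((p : ℝ) + 1) / (a : ℝ) ^ 2)
    (h : ω.IsTorusLimitOfMixture (sectorGibbsCount n) (fun L => sectorGibbsWeightTT' β t t' U n L)
      (fun L => sectorGibbsVectorTT' t t' U n L) Ls)
    (hLs : Tendsto Ls atTop atTop) {βh : ℝ} (hβh : 0 < βh) (hlt : βh < β)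
    (hbox : ∀ᶠ j in atTop, ∃ K, 2 ≤ K ∧ Ls j = K * a)
    {zp zq : ℝ} (hzp0 : 0 < zp)
    (hzp : zp ≤ (partitionFn β (spinSectorHamiltonian p p (hubbardOpenBoxTT' a a t t' U))).re)
    (hzq0 : 0 < zq)
    (hzq : zq ≤ (partitionFn β (spinSectorHamiltonian (p + 1) (p + 1) (hubbardOpenBoxTT' a a t t' U))).re)
    {uh C : ℝ}
    (huh : ∀ᶠ j in atTop, Real.log (partitionFn βh (sectorHamiltonianTT' t t' U n (Ls j))).re ≤
      uh * (Ls j : ℝ) ^ 2 + C) :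
    ω.meanEnergy (hubbardTTPrimeFermionInteraction t t' U) 1 ≤
      (uh - (Real.log zp + (n * (a : ℝ) ^ 2 / 2 - p) * (Real.log zq - Real.log zp)) / (a : ℝ) ^ 2) /
        (β - βh) := by
  obtain ⟨hn0, hn2⟩ := filling_bounds_of_box_interval ha hp hlo hhi
  exact h.meanEnergy_hubbardTTPrime_le_chord_of_sectorGibbs_of_forall_pos hn0 hn2 hLs hβh hlt
    (fun ε hε => eventually_chord_sub_mul_sq_le_log_partitionFn t t' U n (hβh.le.trans hlt.le) ha hp
      hlo hhi hzp0 hzp hzq0 hzq hLs hbox hε)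
    (fun ε hε => eventually_le_add_mul_sq_of_le_add_const hLs huh hε)

/-- **FILLING-BOX PRODUCER III — hot chord from ONE grand-canonical pressure bound** (`0 < β_h < β`, any
`μ`): with `ω`, the interval, the box floors and the tori as in producer I, an eventual bound
`log Re Z_{β_h}(H_{L_j}(t,t',U) − μN) ≤ P·L_j²` on the grand-canonical torus pressure at `(β_h, μ)` gives, at
EVERY filling `n` of the interval, `e_{Φ(t,t',U)}(ω) ≤ (P − β_h μ n − chord(n))/(β − β_h)` — the hot
free energy is transported affinely in `n`, the target free energy along the chord.
[cite: Ruelle1969, §2.5–2.6, §3.3 (3.16)–(3.18), §3.4] [cite: Israel1979, Lemma II.3.1] -/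
theorem IsTorusLimitOfMixture.meanEnergy_hubbardTTPrime_le_grandCanonical_sub_chord_div_of_fillingBox
    {a p : ℕ} (ha : 1 ≤ a) (hp : p + 1 ≤ a * a)
    (hlo : 2 * (p : ℝ) / (a : ℝ) ^ 2 ≤ n) (hhi : n ≤ 2 * ((p : ℝ) + 1) / (a : ℝ) ^ 2)
    (h : ω.IsTorusLimitOfMixture (sectorGibbsCount n) (fun L => sectorGibbsWeightTT' β t t' U n L)
      (fun L => sectorGibbsVectorTT' t t' U n L) Ls)
    (hLs : Tendsto Ls atTop atTop) {βh : ℝ} (hβh : 0 < βh) (hlt : βh < β)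
    (hbox : ∀ᶠ j in atTop, ∃ K, 2 ≤ K ∧ Ls j = K * a)
    {zp zq : ℝ} (hzp0 : 0 < zp)
    (hzp : zp ≤ (partitionFn β (spinSectorHamiltonian p p (hubbardOpenBoxTT' a a t t' U))).re)
    (hzq0 : 0 < zq)
    (hzq : zq ≤ (partitionFn β (spinSectorHamiltonian (p + 1) (p + 1) (hubbardOpenBoxTT' a a t t' U))).re)
    (μ : ℝ) {P : ℝ}
    (hP : ∀ᶠ j in atTop, Real.log (partitionFn βh (hubbardTorusTT' (Ls j) t t' U -
      (μ : ℂ) • totalNumber)).re ≤ P * (Ls j : ℝ) ^ 2) :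
    ω.meanEnergy (hubbardTTPrimeFermionInteraction t t' U) 1 ≤
      (P - βh * μ * n -
          (Real.log zp + (n * (a : ℝ) ^ 2 / 2 - p) * (Real.log zq - Real.log zp)) / (a : ℝ) ^ 2) /
        (β - βh) := by
  obtain ⟨hn0, hn2⟩ := filling_bounds_of_box_interval ha hp hlo hhi
  exact h.meanEnergy_hubbardTTPrime_le_hot_sub_chord_div_of_fillingBox ha hp hlo hhi hLs hβh hlt hbox
    hzp0 hzp hzq0 hzq (eventually_log_partitionFn_sectorHamiltonianTT'_le_of_grandCanonical t t' U hn0 hn2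
      βh μ hP)

/-- **FILLING-BOX PRODUCER IV — cold chord, a thermal energy FLOOR on the interval** (`0 < β < β_c`): with
`ω`, the interval, the box floors (at the target `β`) and the tori as in producer I, and a cold free-energy
bound with a constant defect, `log Re Z_{β_c}(sectorHamiltonianTT' t t' U n L_j) ≤ u_c·L_j² + C` eventually,
`(chord(n) − u_c)/(β_c − β) ≤ e_{Φ(t,t',U)}(ω)`. [cite: Ruelle1969, §2.5–2.6, §3.3 (3.16)–(3.18)]
[cite: Israel1979, Lemma II.3.1] -/
theorem IsTorusLimitOfMixture.chord_sub_cold_div_le_meanEnergy_hubbardTTPrime_of_fillingBox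
    {a p : ℕ} (ha : 1 ≤ a) (hp : p + 1 ≤ a * a)
    (hlo : 2 * (p : ℝ) / (a : ℝ) ^ 2 ≤ n) (hhi : n ≤ 2 * ((p : ℝ) + 1) / (a : ℝ) ^ 2)
    (h : ω.IsTorusLimitOfMixture (sectorGibbsCount n) (fun L => sectorGibbsWeightTT' β t t' U n L)
      (fun L => sectorGibbsVectorTT' t t' U n L) Ls)
    (hLs : Tendsto Ls atTop atTop) {βc : ℝ} (hβ : 0 < β) (hlt : β < βc)
    (hbox : ∀ᶠ j in atTop, ∃ K, 2 ≤ K ∧ Ls j = K * a)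
    {zp zq : ℝ} (hzp0 : 0 < zp)
    (hzp : zp ≤ (partitionFn β (spinSectorHamiltonian p p (hubbardOpenBoxTT' a a t t' U))).re)
    (hzq0 : 0 < zq)
    (hzq : zq ≤ (partitionFn β (spinSectorHamiltonian (p + 1) (p + 1) (hubbardOpenBoxTT' a a t t' U))).re)
    {uc C : ℝ}
    (huc : ∀ᶠ j in atTop, Real.log (partitionFn βc (sectorHamiltonianTT' t t' U n (Ls j))).re ≤
      uc * (Ls j : ℝ) ^ 2 + C) :
    ((Real.log zp + (n * (a : ℝ) ^ 2 / 2 - p) * (Real.log zq - Real.log zp)) / (a : ℝ) ^ 2 - uc) /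
        (βc - β) ≤
      ω.meanEnergy (hubbardTTPrimeFermionInteraction t t' U) 1 := by
  obtain ⟨hn0, hn2⟩ := filling_bounds_of_box_interval ha hp hlo hhi
  exact h.chord_le_meanEnergy_hubbardTTPrime_of_sectorGibbs_of_forall_pos hn0 hn2 hLs hβ hlt
    (fun ε hε => eventually_chord_sub_mul_sq_le_log_partitionFn t t' U n hβ.le ha hp hlo hhi hzp0 hzp
      hzq0 hzq hLs hbox hε)
    (fun ε hε => eventually_le_add_mul_sq_of_le_add_const hLs huc hε)

/-- **FILLING-BOX PRODUCER I, interval-uniform coarse form**: under the hypotheses of producer I,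
`e_{Φ(t,t',U)}(ω) ≤ (s − min(log z_p, log z_q)/a²)/β` — ONE number for the whole filling interval (given an
entropy constant `s > 2H_b(n/2)`; for a hole-doped interval `2(p+1)/a² ≤ 1` the value at the upper end
serves every `n`, `H_b` being increasing on `[0, 1/2]`). [cite: Ruelle1969, §3.3 (3.16)–(3.18)]
[cite: Israel1979, Lemma II.3.1] -/
theorem IsTorusLimitOfMixture.meanEnergy_hubbardTTPrime_le_entropy_sub_min_div_of_fillingBox
    {a p : ℕ} (ha : 1 ≤ a) (hp : p + 1 ≤ a * a)
    (hlo : 2 * (p : ℝ) / (a : ℝ) ^ 2 ≤ n) (hhi : n ≤ 2 * ((p : ℝ) + 1) / (a : ℝ) ^ 2)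
    (h : ω.IsTorusLimitOfMixture (sectorGibbsCount n) (fun L => sectorGibbsWeightTT' β t t' U n L)
      (fun L => sectorGibbsVectorTT' t t' U n L) Ls)
    (hLs : Tendsto Ls atTop atTop) (hβ : 0 < β) (hbox : ∀ᶠ j in atTop, ∃ K, 2 ≤ K ∧ Ls j = K * a)
    {zp zq : ℝ} (hzp0 : 0 < zp)
    (hzp : zp ≤ (partitionFn β (spinSectorHamiltonian p p (hubbardOpenBoxTT' a a t t' U))).re)
    (hzq0 : 0 < zq)
    (hzq : zq ≤ (partitionFn β (spinSectorHamiltonian (p + 1) (p + 1) (hubbardOpenBoxTT' a a t t' U))).re)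
    {s : ℝ} (hs : 2 * Real.binEntropy (n / 2) < s) :
    ω.meanEnergy (hubbardTTPrimeFermionInteraction t t' U) 1 ≤
      (s - min (Real.log zp) (Real.log zq) / (a : ℝ) ^ 2) / β := by
  have h1 := h.meanEnergy_hubbardTTPrime_le_entropy_sub_chord_div_of_fillingBox ha hp hlo hhi hLs hβ hbox
    hzp0 hzp hzq0 hzq hs
  have h2 := min_log_div_sq_le_chord ha hlo hhi zp zq
  refine h1.trans (div_le_div_of_nonneg_right ?_ hβ.le)
  linarith

/-- On the hole-doped side the entropy constant is monotone: `0 ≤ x ≤ y ≤ 1 ⇒ 2H_b(x/2) ≤ 2H_b(y/2)`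
(re-derived; private in `TorusSectorGibbsFillingBoxWindow`). [folklore] -/
private theorem two_mul_binEntropy_half_le_of_le_of_le_one' {x y : ℝ} (hx : 0 ≤ x) (hxy : x ≤ y)
    (hy : y ≤ 1) : 2 * Real.binEntropy (x / 2) ≤ 2 * Real.binEntropy (y / 2) := by
  have hmono := Real.binEntropy_strictMonoOn.monotoneOn
  have hx' : x / 2 ∈ Set.Icc (0 : ℝ) 2⁻¹ := ⟨by linarith, by rw [inv_eq_one_div]; linarith⟩
  have hy' : y / 2 ∈ Set.Icc (0 : ℝ) 2⁻¹ := ⟨by linarith, by rw [inv_eq_one_div]; linarith⟩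
  have := hmono hx' hy' (by linarith)
  linarith

/-- **FILLING-BOX PRODUCER I, hole-doped interval, ONE number**: if moreover the interval is hole-doped,
`2(p+1)/a² ≤ 1`, then for every `s > 2 H_b((p+1)/a²)` (the entropy constant at the UPPER end) and every
filling `n` of the interval, `e_{Φ(t,t',U)}(ω) ≤ (s − min(log z_p, log z_q)/a²)/β` — a thermal energy cap
uniform on `[2p/a², 2(p+1)/a²]` from two box partition functions, the `T > 0` twin of the filling-box cap
`energyDensityTT'_le_max_of_mem_Icc`. [cite: Ruelle1969, §3.3 (3.16)–(3.18)] [cite: Israel1979, Lemma II.3.1] -/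
theorem IsTorusLimitOfMixture.meanEnergy_hubbardTTPrime_le_of_fillingBox_holeDoped
    {a p : ℕ} (ha : 1 ≤ a) (hp : p + 1 ≤ a * a) (hhole : 2 * ((p : ℝ) + 1) / (a : ℝ) ^ 2 ≤ 1)
    (hlo : 2 * (p : ℝ) / (a : ℝ) ^ 2 ≤ n) (hhi : n ≤ 2 * ((p : ℝ) + 1) / (a : ℝ) ^ 2)
    (h : ω.IsTorusLimitOfMixture (sectorGibbsCount n) (fun L => sectorGibbsWeightTT' β t t' U n L)
      (fun L => sectorGibbsVectorTT' t t' U n L) Ls)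
    (hLs : Tendsto Ls atTop atTop) (hβ : 0 < β) (hbox : ∀ᶠ j in atTop, ∃ K, 2 ≤ K ∧ Ls j = K * a)
    {zp zq : ℝ} (hzp0 : 0 < zp)
    (hzp : zp ≤ (partitionFn β (spinSectorHamiltonian p p (hubbardOpenBoxTT' a a t t' U))).re)
    (hzq0 : 0 < zq)
    (hzq : zq ≤ (partitionFn β (spinSectorHamiltonian (p + 1) (p + 1) (hubbardOpenBoxTT' a a t t' U))).re)
    {s : ℝ} (hs : 2 * Real.binEntropy (((p : ℝ) + 1) / (a : ℝ) ^ 2) < s) :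
    ω.meanEnergy (hubbardTTPrimeFermionInteraction t t' U) 1 ≤
      (s - min (Real.log zp) (Real.log zq) / (a : ℝ) ^ 2) / β := by
  have hn0 : 0 ≤ n := le_trans (by positivity) hlo
  have hent : 2 * Real.binEntropy (n / 2) ≤ 2 * Real.binEntropy (((p : ℝ) + 1) / (a : ℝ) ^ 2) := by
    have e : ((p : ℝ) + 1) / (a : ℝ) ^ 2 = (2 * ((p : ℝ) + 1) / (a : ℝ) ^ 2) / 2 := by ring
    rw [e]
    exact two_mul_binEntropy_half_le_of_le_of_le_one' hn0 hhi hhole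
  exact h.meanEnergy_hubbardTTPrime_le_entropy_sub_min_div_of_fillingBox ha hp hlo hhi hLs hβ hbox hzp0 hzp
    hzq0 hzq (lt_of_le_of_lt hent hs)

end InfVolFermionState

/-! ### §3 Box-built tori -/

section Tori

/-- The tori `L_j = a(j+2)` are built of `K_j = j + 2 ≥ 2` blocks of side `a` (the hypothesis `hbox` of §2,
with NO condition on the sector). [cite: LeBlancEtAl2015, eq. (1)] -/
theorem eventually_exists_box_decomposition (a : ℕ) :
    ∀ᶠ j : ℕ in atTop, ∃ K, 2 ≤ K ∧ a * (j + 2) = K * a :=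
  Eventually.of_forall fun j => ⟨j + 2, by omega, by ring⟩

/-- The tori `L_j = a(j+2)` exhaust (`a ≥ 1`; the cluster sequences of fixed-density studies).
[cite: LeBlancEtAl2015, eq. (1)] -/
theorem tendsto_box_tori {a : ℕ} (ha : 1 ≤ a) : Tendsto (fun j : ℕ => a * (j + 2)) atTop atTop :=
  (tendsto_id.const_mul_atTop' (by omega : 0 < a)).comp (tendsto_add_atTop_nat 2)

end Tori

end Literature.MathematicalPhysics.QuantumLattice
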